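import Summits.Ventures.Crystal3D.Theorems.StickyWulffConstantNoReconstructionGainExactPartnerReplication
import Summits.Ventures.Crystal3D.Theorems.StickyWulffConstantNoReconstructionGainAntipodalFilm
import HarnessLib

/-!
# No criminal has antipodally supported contact shells (line `replication-exactness`)

HONEST FRAMING. Part of the venture `Summits/Ventures/Crystal3D` (cell `crystal3d-full`), supports the
crux `NoReconstructionGain` (stmt-Ventures-19144, route `route-Ventures-StickyWulffConstant`), line
`replication-exactness` (lead wulff-p1 g18).  First instantiation of the PARTNER licence
`not_isCriminal_of_partnerAtom` (`…ExactPartnerReplication`), with the landed rung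
`antipodalFilm_adhesion` (`…AntipodalFilm`: if every film ball has at most six contacts, or all its
contacts lie on at most six lines through its centre — `x = q ± w`, `w ∈ W`, `#W ≤ 6` — and no film
ball touching the sample lies in the sample region, the film gains at most `C ρ`, every normal).

* `not_isCriminal_of_antipodal` — a film on `H(ν,s)` each of whose balls has at most six partners
  (plugs + film balls) or has all its partners on at most six lines through its centre is not a
  criminal, on any face.  (Lattice balls have this pattern with the six bond lines of `Λ₀`; here the
  six lines may vary from ball to ball and need not be lattice directions.)

WHAT THIS IS NOT: shells not supported by six lines (e.g. icosahedral fragments) are not covered; the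
crux is not moved; rung F-C1 not moved.
-/

noncomputable section

namespace Summit.Ventures.Crystal3D.Theorems

open Summit.Ventures.Crystal3D
open Literature.MathematicalPhysics.StatisticalMechanics (fccStacking contactDeficiency)
open scoped InnerProductSpace
open Finset

open scoped Classical in
/-- **No criminal with antipodally supported shells.**  If every ball `q` of a film on `H(ν,s)` has
at most six partners (plugs and film balls at distance `1`), or there are at most six vectors `W`
with every partner of the form `q + w` or `q − w` (`w ∈ W`), the film is not a criminal. -/
theorem not_isCriminal_of_antipodal {ν : EuclideanSpace ℝ (Fin 3)} (hν : ‖ν‖ = 1) {s : ℝ}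
    {Q : Finset (EuclideanSpace ℝ (Fin 3))}
    (hQ : ∀ q ∈ Q, (plugSet ν s q).ncard + (Q.filter fun x => dist q x = 1).card ≤ 6 ∨
      ∃ W : Finset (EuclideanSpace ℝ (Fin 3)), W.card ≤ 6 ∧
        ∀ x, (x ∈ plugSet ν s q ∨ (x ∈ Q ∧ dist q x = 1)) → ∃ w ∈ W, x = q + w ∨ x = q - w) :
    ¬ IsCriminal ν s Q := by
  obtain ⟨R, C, hR, h⟩ := antipodalFilm_adhesion
  -- the pattern: few partners, or partners on six lines
  refine not_isCriminal_of_partnerAtom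
    (Pf := fun q A B => A.card + B.card ≤ 6 ∨ ∃ W : Finset (EuclideanSpace ℝ (Fin 3)), W.card ≤ 6 ∧
      ∀ x ∈ A ∪ B, ∃ w ∈ W, x = q + w ∨ x = q - w) (C := C) ?_ hν hR ?_ ?_
  · -- covariance
    rintro q A B hq t -
    rcases hq with hq | ⟨W, hW, hq⟩
    · left
      rw [Finset.card_image_of_injective _ (add_left_injective t),
        Finset.card_image_of_injective _ (add_left_injective t)]
      exact hq
    · right
      refine ⟨W, hW, fun x hx => ?_⟩
      rw [← Finset.image_union, Finset.mem_image] at hx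
      obtain ⟨a, ha, rfl⟩ := hx
      obtain ⟨w, hw, hor⟩ := hq a ha
      refine ⟨w, hw, ?_⟩
      rcases hor with rfl | rfl
      · left; abel
      · right; abel
  · -- the atom
    intro ρ hρ X P hpack hPX hP habove hPf
    refine h ν hν ρ hρ X P hpack hPX hP (fun q hq => ?_) (fun q hq p _ _ hreg => ?_)
    · have hsplit : (X.filter fun x => dist q x = 1) =
          (P.filter fun p => dist q p = 1) ∪ ((X \ P).filter fun x => dist q x = 1) := by
        rw [← Finset.filter_union, Finset.union_sdiff_of_subset hPX]
      have hdisj : Disjoint (P.filter fun p => dist q p = 1) ((X \ P).filter fun x => dist q x = 1) :=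
        Finset.disjoint_filter_filter Finset.disjoint_sdiff
      rcases hPf q hq with h1 | ⟨W, hW, h2⟩
      · left
        rw [hsplit, Finset.card_union_of_disjoint hdisj]
        exact h1
      · right
        refine ⟨W, hW, fun x hx hd => h2 x ?_⟩
        rw [← hsplit, Finset.mem_filter]
        exact ⟨hx, hd⟩
    · have := habove q hq
      linarith only [this, hreg.2.1]
  · -- the film's pattern
    intro q hq
    have hfin := plugSet_finite ν s q
    rcases hQ q hq with h1 | ⟨W, hW, h2⟩
    · left
      rw [← Set.ncard_eq_toFinset_card _ hfin]
      exact h1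
    · right
      refine ⟨W, hW, fun x hx => h2 x ?_⟩
      rw [Finset.mem_union, Set.Finite.mem_toFinset, Finset.mem_filter] at hx
      exact hx

end Summit.Ventures.Crystal3D.Theorems

end
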